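import Summits.QuantumFields.BalabanUV.Beta.GAN24.PiBmConstants
import Summits.QuantumFields.BalabanUV.Beta.AxialDressingRootedBmDress

/-!
# `BalabanUV.Beta.GAN24.TableSlotCoDressCharge` — binder row G-an2-4 ∕ (CONV-C), W-slot CT-W, route «WC-TL» ∕ «QR-LL», K-LL-4 (leaf-01 g66 R-1 ∕ Q-66-2; the OWNER's
# RULING R-gan24p1-g29-1, law (L3)): **THE SLOT CHARGE OF THE CO-DRESSED LETTER IS `N` TIMES ITS FACE-CROSSING COMPONENT** — for an2's block-mean bond-slot
# co-projector `coProjBmAtK ρ N S` (the letter side of the dressed table leg, `TableSlotCoDress.push₃_bmW_table_eq`), the total slot charge in direction `κ` at a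
# fixed kernel entry is `Σ'_q (coProjBmAtK ρ N S) κ q x z a b = N · Σ'_p [p_κ % N = N − 1] · S κ p x z a b`: INDEPENDENT of the letter's own slot charge, it is
# `N` times the sum of the letter's slot components on the bonds CROSSING a block face in direction `κ` — i.e. the block-flux dipole `Σ_B Φ_B(S)·c̄_{B,κ}` of the
# ruling (row owner `b2b-balaban-gan24-p1`, gen 29)

NOT IN PRINT; OUR BOOKKEEPING ([folklore] tsum bookkeeping: an2's window form `coProjBmAt_apply` ∕ `abs_pmBm_le`, gan24-p4 g28's ROW SUMS of the matrix of `Π_bm`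
`PiBmConstants.sum_cube_pmBm_row` («`Π_bm` of a constant 1-form is `N` times the indicator of the bonds crossing a block face», the row owner's RULINGS-16 (R16-1)),
the lead's `KKTFluctuationEnergy.tsum_shift_sub`, Bałaban-road `summable_slice_of_locStencil`; 0 cited facts, 0 `def`, 0 `def … : Prop`, 0 sorry).  HONEST FRAMING (cell contract,
verbatim): «discharging `BetaPertH` makes Bałaban's UV stability UNCONDITIONAL — a real constructive-QFT result; it is NOT the continuum limit and NOT the Clay problem.»
HONEST DEPENDENCY (verbatim): «continuum YM on T⁴ ⇐ BetaPertH ∧ nine spine estimates (0/9 proved); BetaPertH ⇐ (D1) ∧ (D4) ∧ CAP+tail; G-an2-4 gates asym, D1 and NE2/3/4.»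

WHY.  By `TableSlotCoDress` the dressed table leg of the literal's S-step acts on a letter `S` as the undressed leg on `coProjBmAtK ρ Lc S`; the first slot moment that the
undressed push sees is the slot CHARGE.  (L1) (`D1BFx.CoProjBmDivergence.divV_coProjBmAtK`) and leaf-02's `CoProjBmDivFree` say the co-dressing fixes divergence-free
slots; THIS file says what it does to the charge: it FORGETS the letter's own charge and returns `N ×` the face-crossing component — zero for a letter living inside one
block away from its faces, `N·Φ` for a letter with flux `Φ` through one face (ENGINE E31 G1: `M0(s̃) = 3.0000·Φ·e_ν` at a face label, `0.000` at the interior label).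
Discharges NOTHING of K-LL-4 ∕ (Q-R) ∕ (LT) by itself; asserts NO size of any letter.

WHAT (generic `d`, `1 ≤ N`, in-block root `toSite r`).
§1 `summable_pmBm_mul_shift` (bookkeeping); **`tsum_coProjBmAt_eq`** — for a one-form `g` with summable components,
   `Σ'_q coProjBmAt ρ N g κ q = N · Σ'_p (if p κ % N = N − 1 then g κ p else 0)`.
§2 **`tsum_coProjBmAtK_slot_eq`** — the same for an2's `MKer`-valued bond slot at every kernel entry; **`tsum_coProjBmAtK_slot_eq_of_locStencil`** — on the
   `LocStencil` class (slices summable by `summable_slice_of_locStencil`); **`tsum_coProjBmAtK_slot_eq_zero_of_faceFree`** — a letter with NO component on the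
   `κ`-face-crossing bonds has ZERO co-dressed slot charge in direction `κ`, WHATEVER its own charge.
[folklore]; 0 cited facts, 0 `def`, 0 `def … : Prop`, 0 sorry.  NOTHING of (Q-R) ∕ (LT) ∕ (LAY) ∕ (S) ∕ «T2Shape» ∕ «T2Drift» ∕ (hW, hWall) discharged; NEVER «G-an2-4 closed» as (CONV-C);
NOT D1, NOT `BetaPertH`, NOT continuum, NOT Clay.  2026-08-22; no existing file touched.
-/

noncomputable section

open Finset
open scoped BigOperators
open Literature.MathematicalPhysics.QuantumFieldTheory
open Literature.MathematicalPhysics.QuantumFieldTheory.Balaban1983to89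
open Literature.MathematicalPhysics.QuantumFieldTheory.Balaban1983to89.Beta
open ExpKernelCalculus (MKer)
open AffineAveraging (Form1 Site box toSite)
open OneStepResolventKernel (Fib LocStencil)
open BalabanCompositeJets (summable_slice_of_locStencil)
open KKTFluctuationEnergy (tsum_shift tsum_shift_sub)
open Summit.QuantumFields.BalabanUV.Beta.AxialDressingRooted (pmBm cube abs_pmBm_le coProjBmAt coProjBmAt_apply coProjBmAtK coProjBmAtK_eval)
open Summit.QuantumFields.BalabanUV.Beta.GAN24.PiBmConstants (sum_cube_pmBm_row)

namespace Summit.QuantumFields.BalabanUV.Beta.GAN24.TableSlotCoDressCharge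

variable {d : ℕ}

/-! ## §1 The slot total of the co-projected one-form -/

/-- [folklore] Bookkeeping: a bounded matrix row of `Π_bm` against a shifted summable component is summable. -/
theorem summable_pmBm_mul_shift {N : ℕ} (hN : 1 ≤ N) {r : Fin (d + 1) → ℕ} (hr : r ∈ box (d + 1) N)
    {g : Form1 (d + 1) ℝ} (hg : ∀ β, Summable (g β)) (κ β : Fin (d + 1)) (v : Site (d + 1)) :
    Summable fun q : Site (d + 1) => pmBm (toSite r) N β (q + v) κ q * g β (q + v) := by
  have hs : Summable fun q : Site (d + 1) => g β (q + v) := (Equiv.addRight v).summable_iff.2 (hg β)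
  refine Summable.of_norm_bounded (hs.abs.mul_left (1 + 4 * (((d : ℝ) + 1) * N))) fun q => ?_
  rw [Real.norm_eq_abs, abs_mul]
  exact mul_le_mul_of_nonneg_right (abs_pmBm_le hN hr β (q + v) κ q) (abs_nonneg _)

/-- [folklore] **THE SLOT TOTAL OF THE CO-PROJECTED ONE-FORM IS `N` TIMES ITS FACE-CROSSING COMPONENT**: for a one-form `g` with summable components, an in-block
root and `1 ≤ N`, `Σ'_q coProjBmAt ρ N g κ q = N · Σ'_p (if p κ % N = N − 1 then g κ p else 0)` — the window form of `Πᵀ_bm`, one lattice shift per window offset, and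
the ROW SUMS of the matrix of `Π_bm` (`PiBmConstants.sum_cube_pmBm_row`). -/
theorem tsum_coProjBmAt_eq {N : ℕ} (hN : 1 ≤ N) {r : Fin (d + 1) → ℕ} (hr : r ∈ box (d + 1) N)
    {g : Form1 (d + 1) ℝ} (hg : ∀ β, Summable (g β)) (κ : Fin (d + 1)) :
    ∑' q, coProjBmAt (toSite r) N g κ q = (N : ℝ) * ∑' p, (if p κ % (N : ℤ) = (N : ℤ) - 1 then g κ p else 0) := by
  -- the window form, finite sums out of the series
  have e1 : (fun q => coProjBmAt (toSite r) N g κ q)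
      = fun q => ∑ v ∈ cube (d + 1) N, ∑ β : Fin (d + 1), pmBm (toSite r) N β (q + v) κ q * g β (q + v) := by
    funext q; rw [coProjBmAt_apply]
  rw [e1, Summable.tsum_finsetSum (fun v _ => summable_sum fun β _ => summable_pmBm_mul_shift hN hr hg κ β v)]
  have e2 : ∀ v ∈ cube (d + 1) N, ∑' q, ∑ β : Fin (d + 1), pmBm (toSite r) N β (q + v) κ q * g β (q + v)
      = ∑' p, ∑ β : Fin (d + 1), pmBm (toSite r) N β p κ (p - v) * g β p := by
    intro v _
    -- shift `q ↦ p − v`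
    rw [← tsum_shift_sub (fun q => ∑ β : Fin (d + 1), pmBm (toSite r) N β (q + v) κ q * g β (q + v)) v]
    exact tsum_congr fun p => by simp only [sub_add_cancel]
  rw [Finset.sum_congr rfl e2]
  -- exchange the finite sums with the series again and read the row sums
  have hsp : ∀ (β : Fin (d + 1)) (v : Site (d + 1)), Summable fun p : Site (d + 1) => pmBm (toSite r) N β p κ (p - v) * g β p := by
    intro β v
    refine Summable.of_norm_bounded ((hg β).abs.mul_left (1 + 4 * (((d : ℝ) + 1) * N))) fun p => ?_
    rw [Real.norm_eq_abs, abs_mul]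
    exact mul_le_mul_of_nonneg_right (abs_pmBm_le hN hr β p κ (p - v)) (abs_nonneg _)
  rw [← Summable.tsum_finsetSum (fun v _ => summable_sum fun β _ => hsp β v)]
  have e3 : (fun p => ∑ v ∈ cube (d + 1) N, ∑ β : Fin (d + 1), pmBm (toSite r) N β p κ (p - v) * g β p)
      = fun p => (N : ℝ) * (if p κ % (N : ℤ) = (N : ℤ) - 1 then g κ p else 0) := by
    funext p
    rw [Finset.sum_comm]
    have e4 : ∀ β : Fin (d + 1), ∑ v ∈ cube (d + 1) N, pmBm (toSite r) N β p κ (p - v) * g β p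
        = (if β = κ ∧ p β % (N : ℤ) = (N : ℤ) - 1 then (N : ℝ) else 0) * g β p := by
      intro β
      rw [← Finset.sum_mul, sum_cube_pmBm_row hN hr β p κ]
    rw [Finset.sum_congr rfl fun β _ => e4 β]
    rw [Finset.sum_eq_single κ (fun β _ hβ => by rw [if_neg (fun h => hβ h.1), zero_mul]) (fun h => (h (Finset.mem_univ κ)).elim)]
    by_cases hf : p κ % (N : ℤ) = (N : ℤ) - 1
    · rw [if_pos ⟨rfl, hf⟩, if_pos hf]
    · rw [if_neg (fun h => hf h.2), if_neg hf, zero_mul, mul_zero]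
  rw [e3, tsum_mul_left]

/-! ## §2 The `MKer`-valued bond slot: the co-dressed letter's slot charge -/

/-- [folklore] **THE SLOT CHARGE OF THE CO-DRESSED LETTER** (law (L3) of RULING R-gan24p1-g29-1): at every kernel entry `(x, z, a, b)` whose slot slices are summable,
`Σ'_q coProjBmAtK ρ N S κ q x z a b = N · Σ'_p (if p κ % N = N − 1 then S κ p x z a b else 0)` — `N` times the letter's component on the `κ`-face-crossing bonds,
whatever the letter's own slot charge. -/
theorem tsum_coProjBmAtK_slot_eq {N : ℕ} (hN : 1 ≤ N) {r : Fin (d + 1) → ℕ} (hr : r ∈ box (d + 1) N)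
    (S : Fin (d + 1) → (Fin (d + 1) → ℤ) → MKer (d + 1) (Fib d)) (κ : Fin (d + 1)) (x z : Fin (d + 1) → ℤ) (a b : Fib d)
    (hS : ∀ β, Summable fun p => S β p x z a b) :
    ∑' q, coProjBmAtK (toSite r) N S κ q x z a b = (N : ℝ) * ∑' p, (if p κ % (N : ℤ) = (N : ℤ) - 1 then S κ p x z a b else 0) := by
  have e : (fun q => coProjBmAtK (toSite r) N S κ q x z a b) = fun q => coProjBmAt (toSite r) N (fun β p => S β p x z a b) κ q := by
    funext q; rw [coProjBmAtK_eval]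
  rw [e]
  exact tsum_coProjBmAt_eq hN hr (g := fun β p => S β p x z a b) hS κ

/-- [folklore] The same on the `LocStencil` class (every slice is summable). -/
theorem tsum_coProjBmAtK_slot_eq_of_locStencil {N : ℕ} (hN : 1 ≤ N) {r : Fin (d + 1) → ℕ} (hr : r ∈ box (d + 1) N)
    {S : Fin (d + 1) → (Fin (d + 1) → ℤ) → MKer (d + 1) (Fib d)} {Cs δ : ℝ} (hS : LocStencil S Cs δ) (hδ : 0 < δ)
    (κ : Fin (d + 1)) (x z : Fin (d + 1) → ℤ) (a b : Fib d) :
    ∑' q, coProjBmAtK (toSite r) N S κ q x z a b = (N : ℝ) * ∑' p, (if p κ % (N : ℤ) = (N : ℤ) - 1 then S κ p x z a b else 0) :=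
  tsum_coProjBmAtK_slot_eq hN hr S κ x z a b fun β => summable_slice_of_locStencil hS hδ β x z a b

/-- [folklore] **A LETTER WITH NO COMPONENT ON THE `κ`-FACE-CROSSING BONDS HAS ZERO CO-DRESSED SLOT CHARGE IN DIRECTION `κ`** — whatever its own slot charge
(ENGINE E31: the interior label's kernel-valued slot charge 136.7 → 0.000 under the co-dressing). -/
theorem tsum_coProjBmAtK_slot_eq_zero_of_faceFree {N : ℕ} (hN : 1 ≤ N) {r : Fin (d + 1) → ℕ} (hr : r ∈ box (d + 1) N)
    (S : Fin (d + 1) → (Fin (d + 1) → ℤ) → MKer (d + 1) (Fib d)) (κ : Fin (d + 1)) (x z : Fin (d + 1) → ℤ) (a b : Fib d)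
    (hS : ∀ β, Summable fun p => S β p x z a b)
    (hface : ∀ p : Fin (d + 1) → ℤ, p κ % (N : ℤ) = (N : ℤ) - 1 → S κ p x z a b = 0) :
    ∑' q, coProjBmAtK (toSite r) N S κ q x z a b = 0 := by
  rw [tsum_coProjBmAtK_slot_eq hN hr S κ x z a b hS]
  have e : (fun p : Fin (d + 1) → ℤ => (if p κ % (N : ℤ) = (N : ℤ) - 1 then S κ p x z a b else 0)) = fun _ => 0 := by
    funext p
    by_cases h : p κ % (N : ℤ) = (N : ℤ) - 1
    · rw [if_pos h, hface p h]
    · rw [if_neg h]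
  rw [e, tsum_zero, mul_zero]

end Summit.QuantumFields.BalabanUV.Beta.GAN24.TableSlotCoDressCharge

end
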